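import Literature.NumberTheory.EllipticCurves.ZpExtensionEisensteinSelmerStructure
import Mathlib.CategoryTheory.CofilteredSystem
import Mathlib.CategoryTheory.Functor.OfSequence
import HarnessLib

/-!
# Kőnig's lemma for towers of finite abelian groups: a class liftable to every finite stage lifts to a
# compatible family (theorems only; no definition, no named fact, no instance)

Topic `NumberTheory/EllipticCurves` (companion of `ZpExtensionEisensteinSelmerStructure`, §1 `Tower`). For a tower
`… → H_{j+1} → H_j → … → H_0` of FINITE abelian groups (`H_j = H¹(K_v, T/p^j T)` for a compact module `T` of finite
level over a local field) the inverse limit `lim_j H_j = Tower.compatibleFamilies red` surjects onto the "universally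
liftable" classes: `y ∈ H_i` is the `i`-th component of a compatible family as soon as, for every `ℓ`, it is the
`i`-th component of a family compatible BELOW level `ℓ` (`Tower.exists_mem_compatibleFamilies_of_forall_partial`;
Mathlib's `nonempty_sections_of_finite_inverse_system` = Kőnig / Mittag-Leffler for finite sets, applied to the sets of
level-`ℓ` components of partial compatible families through `y`). Corollary: the image of `lim_j H_j → H_i` is the
intersection over `ℓ ≥ i` of the images of the iterated reductions (stated without iterated maps:
`Tower.mem_range_eval_compatibleFamilies_iff`). This is the compactness input of the exactness statements about
`H¹(K_v, T_𝔮) = lim_k H¹(K_v, T_𝔮/p^k)` (liftability, `ker (eval_j) = p^j · lim`) used for Howard's hypothesis H.3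
(cartesian local conditions) for the saturated Selmer structure `F_𝔮` (cell `pub/bsd-print-x9`, memo H3-CARTESIAN-PLAN).

References: [SerreGaloisCohomology1997] J.-P. Serre, *Galois Cohomology*, I §2.2 (cohomology with values in a projective
limit of finite modules: `Hⁿ(G, lim A_i) = lim Hⁿ(G, A_i)`, via compactness); [NeukirchSchmidtWingberg2008] Cor. 2.7.6
(Mittag-Leffler for profinite/finite systems).
-/

noncomputable section

open CategoryTheory

universe u

namespace Literature.NumberTheory.EllipticCurves

namespace Tower

variable {H : ℕ → Type u} [∀ j, AddCommGroup (H j)] (red : ∀ j, H (j + 1) →+ H j)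

/-- **Kőnig's lemma for a tower of finite abelian groups.** If `y ∈ H_i` is, for every `ℓ`, the `i`-th component of
a family `x` compatible at all levels `< ℓ` (`red_j x_{j+1} = x_j` for `j < ℓ`), then `y` is the `i`-th component of a
family compatible at ALL levels (an element of `lim_j H_j = compatibleFamilies red`). Proof: the sets
`C_ℓ = {x_ℓ | x compatible below max i ℓ, x_i = y} ⊆ H_ℓ` are finite, nonempty, and mapped into each other by the
reductions; a section of this inverse system of finite nonempty sets (Mathlib
`nonempty_sections_of_finite_inverse_system`) is the required family.
[cite: SerreGaloisCohomology1997, Ch. I §2.2 (limits of finite modules; compactness)]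
[cite: NeukirchSchmidtWingberg2008, Cor. 2.7.6 (Mittag-Leffler)] -/
theorem exists_mem_compatibleFamilies_of_forall_partial [∀ j, Finite (H j)] (i : ℕ) (y : H i)
    (h : ∀ ℓ : ℕ, ∃ x : Π j, H j, (∀ j, j < ℓ → red j (x (j + 1)) = x j) ∧ x i = y) :
    ∃ x ∈ compatibleFamilies red, x i = y := by
  classical
  -- the finite nonempty sets of level-`ℓ` components of partial compatible families through `y`
  let C : ℕ → Type u := fun ℓ ↦
    {w : H ℓ // ∃ x : Π j, H j, (∀ j, j < max i ℓ → red j (x (j + 1)) = x j) ∧ x i = y ∧ x ℓ = w}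
  have hCne : ∀ ℓ, Nonempty (C ℓ) := fun ℓ ↦ by
    obtain ⟨x, hx, hxi⟩ := h (max i ℓ)
    exact ⟨⟨x ℓ, x, hx, hxi, rfl⟩⟩
  haveI : ∀ ℓ, Finite (C ℓ) := fun ℓ ↦ Subtype.finite
  -- the transition maps `C (ℓ+1) → C ℓ`, `w ↦ red w`
  let f : ∀ ℓ, C (ℓ + 1) → C ℓ := fun ℓ w ↦
    ⟨red ℓ w.1, by
      obtain ⟨x, hx, hxi, hxw⟩ := w.2
      refine ⟨x, fun j hj ↦ hx j (lt_of_lt_of_le hj (max_le_max le_rfl (Nat.le_succ ℓ))), hxi, ?_⟩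
      rw [← hxw]
      exact (hx ℓ (lt_of_lt_of_le (Nat.lt_succ_self ℓ) (le_max_right _ _))).symm⟩
  let F : ℕᵒᵖ ⥤ Type u := Functor.ofOpSequence (X := C) (fun ℓ ↦ TypeCat.ofHom (f ℓ))
  haveI : ∀ j : ℕᵒᵖ, Finite (F.obj j) := fun j ↦ by
    change Finite (C j.unop); infer_instance
  haveI : ∀ j : ℕᵒᵖ, Nonempty (F.obj j) := fun j ↦ by
    change Nonempty (C j.unop); infer_instance
  obtain ⟨s, hs⟩ := nonempty_sections_of_finite_inverse_system F
  -- the section is a compatible family through `y`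
  refine ⟨fun j ↦ (s (Opposite.op j) : C j).1, ?_, ?_⟩
  · rw [mem_compatibleFamilies_iff]
    intro j
    have hsj := hs (homOfLE (Nat.le_add_right j 1)).op
    rw [Functor.ofOpSequence_map_homOfLE_succ] at hsj
    -- `hsj : f j (s (op (j+1))) = s (op j)`
    exact congrArg Subtype.val hsj
  · change ((s (Opposite.op i) : C i)).1 = y
    obtain ⟨x, -, hxi, hxw⟩ := (s (Opposite.op i) : C i).2
    exact hxw.symm.trans hxi

/-- **The image of `lim_j H_j → H_i` is the set of universally liftable classes** (tower of finite abelian groups):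
`y` is the `i`-th component of a compatible family iff for every `ℓ` it is the `i`-th component of a family
compatible below `ℓ`. [cite: SerreGaloisCohomology1997, Ch. I §2.2] [cite: NeukirchSchmidtWingberg2008, Cor. 2.7.6] -/
theorem mem_range_eval_compatibleFamilies_iff [∀ j, Finite (H j)] (i : ℕ) (y : H i) :
    (∃ x ∈ compatibleFamilies red, x i = y) ↔
      ∀ ℓ : ℕ, ∃ x : Π j, H j, (∀ j, j < ℓ → red j (x (j + 1)) = x j) ∧ x i = y := by
  refine ⟨fun ⟨x, hx, hxi⟩ ℓ ↦ ⟨x, fun j _ ↦ (mem_compatibleFamilies_iff red x).1 hx j, hxi⟩,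
    exists_mem_compatibleFamilies_of_forall_partial red i y⟩

/-- **Level conditions see only universally liftable classes**: a member of `Tower.levelCondition red p C k` is, for
every `ℓ`, the `k`-th component of a family compatible below `ℓ` (trivially, being the component of a compatible
family) — recorded as the form in which liftability is USED. [cite: Howard2004HeegnerKolyvagin, Def. 2.1.1 (propagation to a quotient = image)] -/
theorem exists_partial_of_mem_levelCondition (p : ℕ) (C : ∀ j, AddSubgroup (H j)) {k : ℕ} {y : H k}
    (hy : y ∈ levelCondition red p C k) (ℓ : ℕ) :
    ∃ x : Π j, H j, (∀ j, j < ℓ → red j (x (j + 1)) = x j) ∧ x k = y := by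
  rw [mem_levelCondition_iff] at hy
  obtain ⟨x, hx, rfl⟩ := hy
  exact ⟨x, fun j _ ↦ ((mem_saturatedFamilies_iff red p C x).1 hx).1 j, rfl⟩

end Tower

end Literature.NumberTheory.EllipticCurves

end
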